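import Summits.ResolutionOfSingularities.ResolutionOfSingularities.Theorems.FrobeniusClosingSteerMinimalDegreeRegular
import Summits.ResolutionOfSingularities.ResolutionOfSingularities.Theorems.FrobeniusClosingSteerRegularCurveGermChart
import Summits.ResolutionOfSingularities.ResolutionOfSingularities.Theorems.FrobeniusClosingSteerRegularCurveGermLift
import Summits.ResolutionOfSingularities.ResolutionOfSingularities.Theorems.FrobeniusClosingSteerInsepStepChart
import Literature.AlgebraicGeometry.Resolution.BlowupRingExceptionalFibre
import Literature.AlgebraicGeometry.Resolution.ExcellentRings
import Mathlib.RingTheory.KrullDimension.Regular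
import Mathlib.RingTheory.Jacobson.Ring
import HarnessLib

/-!
# Steer / CLAIM R kernel, file R3c: **a regular curve germ of low degree through a non-rational near point** —
# the hypothesis (K-H) `LemmaI.GeomSupplyRegularCurve` of LEMMA I, assembled

OURS (campaign res-hironaka, rung L ★L-G4, slot W4.1, crux `Steer` stmt-ResolutionOfSingularities-16345; res-L0-w41-plan-1
RULING 160d «CLAIM R kernel `exists_regularCurveGerm_of_nonRational` → first free kernel hands», RULING 171c/179e; res-L0-w41-idea-3 g9;
the statement is VERBATIM the body of `LemmaI.GeomSupplyRegularCurve` of `L/res-L0-w41-idea-3/LemmaISketch.lean` v3.3 (so that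
`exact ClaimR.geomSupplyRegularCurve_holds` closes it); replaces the role of no printed item; NOT a statement of the manuscript under
review [claim: Hironaka2017, status: under-review]; AI review is weaker than expert review). Theses-free, definition-free.

THEOREM (`geomSupplyRegularCurve_holds`). Let `S₀ ≤ S₁ ⊆ L` be a quadratic transform of three-dimensional regular local rings with
exceptional parameter `x₀` (`𝔪₀S₁ = x₀S₁`) and residue-field growth (`κ₁ ≠ κ₀`). Then with `q = [κ₁ : κ₀] ≥ 2` there are a residue basis
`u₁ … u_q ∈ S₁` of `κ₁/κ₀`, a degree `δ` with `δ(δ+1) ≤ 2q`, and `G ∈ 𝔪₀^δ`, `w ∈ S₁` with `G = w·x₀^δ` such that `(x₀, w)` is a prime of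
`S₁` with regular one-dimensional quotient — a regular curve germ on the exceptional divisor through the near point, cut out by a
hypersurface of `S₀` of order `δ`.

PROOF (files R1 `…PlaneBezoutInequality`, R2 `…MinimalDegreeRegular`, R3a `…RegularCurveGermChart`, R3b `…RegularCurveGermLift`).
The chart element `X` of the transform extends to a regular system of parameters `(X, Y, Z)` of `S₀` (`X ∉ 𝔪₀²`, tree
`exists_rsop_apply_eq`); `B = S₀[𝔪₀/X]` maps onto `A = κ₀[T₁, T₂]` with kernel `XB` (`exists_chartMap`, Stacks 0BIQ) and `S₁ = B_𝔮`
(`isLocalizationAtPrime_of_isQuadraticTransform`); the image `𝔫 = Θ(𝔮)` is maximal because `ht 𝔮 = dim S₁ = 3` and `dim A = 2`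
(`isMaximal_map_of_height`); `q = [A/𝔫 : κ₀]`, the residue basis and `q ≥ 2` are `exists_residue_basis` / `two_le_finrank_of_growth`;
R2 (`exists_mem_notMem_sq`) gives `f ∈ 𝔫 ∖ 𝔫²` of degree `≤ δ`, `δ(δ+1) ≤ 2q`; `exists_lift_of_totalDegree_le` lifts it to `w_B ∈ B`,
`G = X^δ w_B ∈ 𝔪₀^δ`; `S₁/(X, w_B)` is regular of dimension `dim S₁/(X) − 1 = 1` (`isRegularLocalRing_quotient_span_pair`, Matsumura
14.2), hence a domain; finally `XS₁ = 𝔪₀S₁ = x₀S₁`, so `X = x₀·v` with `v` a unit and `w := v^δ w_B` has `(x₀, w) = (X, w_B)`,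
`G = w x₀^δ`. The hypotheses `CharP L 2`, `IsExcellentRing S₀`, `Infinite κ₀` of (K-H) are not used.
[cite: Cutkosky2014, §2.1] [cite: Matsumura1987, Thm. 14.2] [cite: StacksProject, Tag 0BIQ] [folklore]
-/

noncomputable section

-- single-problem summit: the doubled namespace component `ResolutionOfSingularities` is forced
set_option linter.dupNamespace false

namespace Summit.ResolutionOfSingularities.ResolutionOfSingularities.Theorems.SwitchingDichotomy.ClaimR

open IsLocalRing Literature.AlgebraicGeometry.Resolution MvPolynomial Module

/-- Dimension bookkeeping in `WithBot ℕ∞`: `n + 1 = d` and `d + 1 = 3` give `n = 1`. [folklore] -/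
theorem natCast_eq_one_of_add_one {n : ℕ} {d : WithBot ℕ∞} (h1 : (n : WithBot ℕ∞) + 1 = d) (h2 : d + 1 = 3) :
    (n : WithBot ℕ∞) = 1 := by
  subst h1
  have h : ((n + 1 + 1 : ℕ) : WithBot ℕ∞) = ((3 : ℕ) : WithBot ℕ∞) := by push_cast; exact h2
  have h' := Nat.cast_injective (R := WithBot ℕ∞) h
  have hn : n = 1 := by omega
  rw [hn, Nat.cast_one]

/-- `κ₀[T₁, T₂]` has Krull dimension `2`, finitely. [cite: Matsumura1987, Thm. 5.6] -/
theorem ringKrullDim_mvPolynomial_fin_two (K : Type*) [Field K] :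
    ringKrullDim (MvPolynomial (Fin 2) K) = (2 : ℕ) ∧ FiniteRingKrullDim (MvPolynomial (Fin 2) K) := by
  have h : ringKrullDim (MvPolynomial (Fin 2) K) = (2 : ℕ) := by
    rw [MvPolynomial.ringKrullDim_of_isNoetherianRing, ringKrullDim_eq_zero_of_field, zero_add,
      Nat.card_eq_fintype_card, Fintype.card_fin]
  refine ⟨h, finiteRingKrullDim_iff_ne_bot_and_top.mpr ⟨?_, ?_⟩⟩
  · rw [h]; exact WithBot.natCast_ne_bot 2
  · rw [h]; exact ne_of_beq_false rfl

/-- `R[𝔪_R/x]` is Noetherian for a Noetherian local subring `R` of a field: it is `R[u₁/x, …, u_k/x]` for generators `uᵢ` of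
`𝔪_R` (tree `blowupRing_eq_closure_of_span_eq`), a finitely generated `R`-algebra. [folklore] -/
theorem isNoetherianRing_blowupRing {K : Type*} [Field K] (R : Subring K) [IsLocalRing R] [IsNoetherianRing R] (x : K) :
    IsNoetherianRing (blowupRing R x) := by
  classical
  obtain ⟨s, hs⟩ := IsNoetherian.noetherian (maximalIdeal R)
  have hrange : Set.range (algebraMap R K) = (R : Set K) := by
    ext z
    constructor
    · rintro ⟨r, rfl⟩; exact r.2
    · intro hz; exact ⟨⟨z, hz⟩, rfl⟩
  have heq : blowupRing R x = (Algebra.adjoin R ((fun y : R => (y : K) / x) '' (s : Set R))).toSubring := by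
    rw [blowupRing_eq_closure_of_span_eq x (s : Set R) hs, Algebra.adjoin_eq_ring_closure, hrange]
  rw [heq]
  have hfg : (Algebra.adjoin R ((fun y : R => (y : K) / x) '' (s : Set R))).FG := by
    rw [← Finset.coe_image]
    exact Subalgebra.fg_adjoin_finset _
  exact isNoetherianRing_of_fg hfg

/-- **(K-H) `LemmaI.GeomSupplyRegularCurve` holds**: a regular curve germ `(x₀, w)` on the exceptional divisor through a non-rational
near point of a point blow-up of a three-dimensional regular local ring, cut out by `G ∈ 𝔪₀^δ` with `δ(δ+1) ≤ 2q`, together with a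
residue basis of `κ₁/κ₀` of length `q ≥ 2`. Statement verbatim the body of `LemmaI.GeomSupplyRegularCurve` (v3.3). OURS. [folklore] -/
theorem geomSupplyRegularCurve_holds :
    ∀ (L : Type) [Field L] [CharP L 2]
      (S₀ S₁ : Subring L) [IsLocalRing S₀] [IsLocalRing S₁] (h₀₁ : S₀ ≤ S₁) (x₀ : S₁),
      IsRegularLocalRing S₀ → IsRegularLocalRing S₁ → IsExcellentRing S₀ →
      ringKrullDim S₀ = 3 → ringKrullDim S₁ = 3 →
      IsQuadraticTransform S₀ S₁ →
      Ideal.span ((fun y : S₀ => (⟨(y : L), h₀₁ y.2⟩ : S₁)) '' (maximalIdeal S₀ : Set S₀)) = Ideal.span {x₀} →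
      Infinite (ResidueField S₀) →
      (∃ u : S₁, ∀ v : S₀, u - ⟨(v : L), h₀₁ v.2⟩ ∉ maximalIdeal S₁) →
      ∃ (q δ : ℕ) (u : Fin q → S₁) (G : S₀) (w : S₁), 2 ≤ q ∧
        (∀ a : Fin q → S₀, (∑ i, (⟨((a i : S₀) : L), h₀₁ (a i).2⟩ : S₁) * u i) ∈ maximalIdeal S₁ →
          ∀ i, a i ∈ maximalIdeal S₀) ∧
        (∀ z : S₁, ∃ a : Fin q → S₀, z - ∑ i, (⟨((a i : S₀) : L), h₀₁ (a i).2⟩ : S₁) * u i ∈ maximalIdeal S₁) ∧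
        G ∈ maximalIdeal S₀ ^ δ ∧ ((G : S₀) : L) = ((w : S₁) : L) * ((x₀ : S₁) : L) ^ δ ∧
        (Ideal.span ({x₀, w} : Set S₁)).IsPrime ∧
        IsRegularLocalRing (S₁ ⧸ Ideal.span ({x₀, w} : Set S₁)) ∧
        ringKrullDim (S₁ ⧸ Ideal.span ({x₀, w} : Set S₁)) = 1 ∧
        δ * (δ + 1) ≤ 2 * q := by
  intro L _ _ S₀ S₁ _ _ h₀₁ x₀ hreg₀ hreg₁ _ hdim₀ hdim₁ hQT hx₀ _ hgrow
  classical
  obtain ⟨_, X, hX, hX0, _, hB, -, hdom⟩ := id hQT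
  /- Step 1: embedding dimension `3`, `X ∉ 𝔪₀²`, a regular system of parameters `z` with `z 0 = X` -/
  have hd : (maximalIdeal S₀).spanFinrank = 3 := by
    have h := IsRegularLocalRing.spanFinrank_maximalIdeal (R := S₀)
    rw [hdim₀] at h
    exact_mod_cast h
  have hX2 : X ∉ maximalIdeal S₀ ^ 2 := IsQuadraticTransform.chart_not_mem_sq hB hdom hX0
  obtain ⟨z, hz, hzX⟩ := exists_rsop_apply_eq hd hX hX2 (0 : Fin 3)
  subst hzX
  have hzm : ∀ j, z j ∈ maximalIdeal S₀ := fun j => hz ▸ Ideal.subset_span ⟨j, rfl⟩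
  have hX0L : ((z 0 : S₀) : L) ≠ 0 := fun e => hX0 (Subtype.ext e)
  /- names: `B = S₀[𝔪₀/X]`, `Xb = X ∈ B`, `ι₀ : S₀ → B`, the inclusion algebra `B → S₁` -/
  let Xb : blowupRing S₀ ((z 0 : S₀) : L) := ⟨((z 0 : S₀) : L), le_blowupRing S₀ _ (z 0).2⟩
  let ι₀ : S₀ →+* blowupRing S₀ ((z 0 : S₀) : L) := Subring.inclusion (le_blowupRing S₀ ((z 0 : S₀) : L))
  letI : Algebra (blowupRing S₀ ((z 0 : S₀) : L)) S₁ := (Subring.inclusion hB).toAlgebra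
  have hincl : ∀ a : S₀, algebraMap (blowupRing S₀ ((z 0 : S₀) : L)) S₁ (ι₀ a) = ⟨(a : L), h₀₁ a.2⟩ := fun _ => rfl
  have hXb' : algebraMap (blowupRing S₀ ((z 0 : S₀) : L)) S₁ Xb = ⟨((z 0 : S₀) : L), h₀₁ (z 0).2⟩ := rfl
  /- Step 2: the chart map `Θ₀ : B ↠ κ₀[T_j : j ≠ 0]` and `Θ : B ↠ κ₀[T₀, T₁]` -/
  obtain ⟨Θ₀, hΘ₀s, hΘ₀k, hΘ₀C, hΘ₀X⟩ := exists_chartMap S₀ hd z hz 0 hX0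
  let eσ : {j : Fin 3 // j ≠ 0} ≃ Fin 2 := (finSuccAboveEquiv (0 : Fin 3)).symm
  let ρ₂ : MvPolynomial {j : Fin 3 // j ≠ 0} (ResidueField S₀) ≃ₐ[ResidueField S₀]
      MvPolynomial (Fin 2) (ResidueField S₀) := renameEquiv _ eσ
  let Θ : blowupRing S₀ ((z 0 : S₀) : L) →+* MvPolynomial (Fin 2) (ResidueField S₀) :=
    (ρ₂ : _ ≃+* _).toRingHom.comp Θ₀
  have hΘapply : ∀ b, Θ b = ρ₂ (Θ₀ b) := fun _ => rfl
  have hΘs : Function.Surjective Θ := ρ₂.surjective.comp hΘ₀s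
  have hΘk : RingHom.ker Θ = Ideal.span {Xb} := by
    rw [← hΘ₀k]; ext b
    rw [RingHom.mem_ker, RingHom.mem_ker, hΘapply, EmbeddingLike.map_eq_zero_iff]
  have hΘC : ∀ s : S₀, Θ (ι₀ s) = algebraMap (ResidueField S₀) _ (residue S₀ s) := by
    intro s
    rw [hΘapply, hΘ₀C, MvPolynomial.algebraMap_eq]
    exact AlgEquiv.commutes ρ₂ _
  /- Step 3: `S₁ = B_𝔮` -/
  haveI hloc : IsLocalization.AtPrime S₁
      ((maximalIdeal S₁).comap (algebraMap (blowupRing S₀ ((z 0 : S₀) : L)) S₁)) :=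
    isLocalizationAtPrime_of_isQuadraticTransform hQT hX hX0 hB
  set 𝔮 : Ideal (blowupRing S₀ ((z 0 : S₀) : L)) :=
    (maximalIdeal S₁).comap (algebraMap (blowupRing S₀ ((z 0 : S₀) : L)) S₁) with h𝔮def
  have hXb𝔮 : Xb ∈ 𝔮 := by
    rw [h𝔮def, Ideal.mem_comap, hXb']
    exact (LemmaI.inclusion_mem_maximalIdeal_iff hdom (z 0)).mpr hX
  /- Step 4: the point `𝔫 = Θ(𝔮)` is a maximal ideal of `κ₀[T₀, T₁]` -/
  set 𝔫 : Ideal (MvPolynomial (Fin 2) (ResidueField S₀)) := 𝔮.map Θ with h𝔫def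
  have h𝔫 : 𝔫.comap Θ = 𝔮 := by
    rw [h𝔫def, Ideal.comap_map_of_surjective _ hΘs, sup_eq_left, ← RingHom.ker_eq_comap_bot, hΘk,
      Ideal.span_le, Set.singleton_subset_iff]
    exact hXb𝔮
  have hq3 : 𝔮.height = (2 : ℕ) + 1 := by
    have h := IsLocalization.AtPrime.ringKrullDim_eq_height 𝔮 S₁
    rw [hdim₁] at h
    have h3 : ((𝔮.height : ℕ∞) : WithBot ℕ∞) = ((3 : ℕ∞) : WithBot ℕ∞) := h.symm
    rw [WithBot.coe_injective h3]
    show (3 : ℕ∞) = (2 : ℕ) + 1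
    norm_num
  obtain ⟨hA2, hAfin⟩ := ringKrullDim_mvPolynomial_fin_two (ResidueField S₀)
  haveI := hAfin
  haveI : IsNoetherianRing (blowupRing S₀ ((z 0 : S₀) : L)) := isNoetherianRing_blowupRing S₀ _
  haveI h𝔫max : 𝔫.IsMaximal := isMaximal_map_of_height 𝔮 Θ hΘs hΘk hXb𝔮 hA2 hq3
  /- Step 5: `q = [κ(𝔫) : κ₀]`, the residue basis, `q ≥ 2` -/
  letI := Ideal.Quotient.field 𝔫
  haveI : Module.Finite (ResidueField S₀) (MvPolynomial (Fin 2) (ResidueField S₀) ⧸ 𝔫) :=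
    finite_of_finite_type_of_isJacobsonRing (ResidueField S₀) _
  have hρ : Function.Surjective (residue S₀) := Ideal.Quotient.mk_surjective
  have hρker : ∀ a : S₀, residue S₀ a = 0 ↔ a ∈ maximalIdeal S₀ := fun a => residue_eq_zero_iff a
  obtain ⟨u, hu1, hu2⟩ := exists_residue_basis (S := S₁) 𝔮 Θ h𝔫 ι₀ (residue S₀) hρ hρker hΘC hΘs
  have hq2 : 2 ≤ finrank (ResidueField S₀) (MvPolynomial (Fin 2) (ResidueField S₀) ⧸ 𝔫) :=
    two_le_finrank_of_growth (S := S₁) 𝔮 Θ h𝔫 ι₀ (residue S₀) hρ hΘC hgrow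
  /- Step 6: R2 — an element `f ∈ 𝔫 ∖ 𝔫²` of degree `≤ δ`, `δ(δ+1) ≤ 2q` -/
  obtain ⟨δ, f, -, hf𝔫, hf2, -, hfdeg, -, hδq⟩ := exists_mem_notMem_sq 𝔫
  /- Step 7: lift `f` to `w_B ∈ B` with `G = X^δ w_B ∈ 𝔪₀^δ` -/
  have hf₀deg : (ρ₂.symm f).totalDegree ≤ δ := by
    change ((renameEquiv (ResidueField S₀) eσ).symm f).totalDegree ≤ δ
    rw [renameEquiv_symm, renameEquiv_apply]
    exact (totalDegree_rename_le _ _).trans hfdeg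
  obtain ⟨wB, G, hΘ₀w, hG, hGw⟩ := exists_lift_of_totalDegree_le S₀ hX hX0L
    (fun j : {j : Fin 3 // j ≠ 0} => z j.1) (fun j => hzm j.1) Θ₀ hΘ₀C
    (fun j => hΘ₀X j (div_mem_blowupRing _ (hzm j.1))) (ρ₂.symm f) hf₀deg
  have hΘw : Θ wB = f := by rw [hΘapply, hΘ₀w, AlgEquiv.apply_symm_apply]
  /- Step 8: `S₁/(X, w_B)` is regular, `dim + 1 = dim S₁/(X)`; `dim S₁/(X) + 1 = 3` -/
  have hXmap : (RingHom.ker Θ).map (algebraMap (blowupRing S₀ ((z 0 : S₀) : L)) S₁) =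
      Ideal.span {algebraMap (blowupRing S₀ ((z 0 : S₀) : L)) S₁ Xb} := by
    rw [hΘk, Ideal.map_span, Set.image_singleton]
  obtain ⟨hreg, hdim⟩ := isRegularLocalRing_quotient_span_pair 𝔮 Θ h𝔫 hΘs hXmap (w := wB)
    (by rw [hΘw]; exact hf𝔫) (by rw [hΘw]; exact hf2)
  set X' : S₁ := algebraMap (blowupRing S₀ ((z 0 : S₀) : L)) S₁ Xb with hX'def
  set w' : S₁ := algebraMap (blowupRing S₀ ((z 0 : S₀) : L)) S₁ wB with hw'def
  have hX'm : X' ∈ maximalIdeal S₁ := Ideal.mem_comap.mp hXb𝔮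
  have hX'0 : X' ≠ 0 := fun e => hX0L (congrArg Subtype.val e)
  have hdimX : ringKrullDim (S₁ ⧸ Ideal.span ({X'} : Set S₁)) + 1 = 3 := by
    rw [← hdim₁]
    exact ringKrullDim_quotient_span_singleton_succ_eq_ringKrullDim_of_mem_nonZeroDivisors
      (mem_nonZeroDivisors_of_ne_zero hX'0) hX'm
  haveI := hreg
  obtain ⟨n, hn⟩ := exists_nat_cast_eq_ringKrullDim (R := S₁ ⧸ Ideal.span ({X', w'} : Set S₁))
  rw [hn] at hdim
  have hn1 := natCast_eq_one_of_add_one hdim hdimX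
  /- Step 9: `x₀S₁ = 𝔪₀S₁ = XS₁`: `X = x₀ v`, `x₀ = X v'`, `v v' = 1` -/
  have hspan : Ideal.span ({x₀} : Set S₁) = Ideal.span {X'} := by
    rw [← hx₀]
    apply le_antisymm
    · rw [Ideal.span_le]
      rintro _ ⟨y, hy, rfl⟩
      exact LemmaI.inclusion_mem_span_exc h₀₁ hB hX0L hy
    · rw [Ideal.span_le, Set.singleton_subset_iff]
      exact Ideal.subset_span ⟨z 0, hzm 0, rfl⟩
  obtain ⟨v, hv⟩ := Ideal.mem_span_singleton'.mp (hspan ▸ Ideal.mem_span_singleton_self X' :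
    X' ∈ Ideal.span ({x₀} : Set S₁))
  obtain ⟨v', hv'⟩ := Ideal.mem_span_singleton'.mp (hspan.symm ▸ Ideal.mem_span_singleton_self x₀ :
    x₀ ∈ Ideal.span ({X'} : Set S₁))
  -- `hv : v * x₀ = X'`, `hv' : v' * X' = x₀`
  have hvv' : v * v' = 1 := by
    have h : (v * v') * X' = 1 * X' := by rw [mul_assoc, hv', hv, one_mul]
    exact mul_right_cancel₀ hX'0 h
  have hv'v : v' * v = 1 := by rw [mul_comm]; exact hvv'
  /- Step 10: `w := v^δ w'`, `(x₀, w) = (X, w_B)`, `G = w x₀^δ` -/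
  have hI : Ideal.span ({x₀, v ^ δ * w'} : Set S₁) = Ideal.span {X', w'} := by
    apply le_antisymm
    · rw [Ideal.span_le]
      rintro s (rfl | rfl)
      · exact Ideal.mem_span_pair.mpr ⟨v', 0, by rw [hv', zero_mul, add_zero]⟩
      · exact Ideal.mem_span_pair.mpr ⟨0, v ^ δ, by rw [zero_mul, zero_add]⟩
    · rw [Ideal.span_le]
      rintro s (rfl | rfl)
      · exact Ideal.mem_span_pair.mpr ⟨v, 0, by rw [hv, zero_mul, add_zero]⟩
      · refine Ideal.mem_span_pair.mpr ⟨0, v' ^ δ, ?_⟩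
        rw [zero_mul, zero_add, ← mul_assoc, ← mul_pow, hv'v, one_pow, one_mul]
  refine ⟨finrank (ResidueField S₀) (MvPolynomial (Fin 2) (ResidueField S₀) ⧸ 𝔫), δ, u, G, v ^ δ * w',
    hq2, hu1, hu2, hG, ?_, ?_, ?_, ?_, hδq⟩
  · -- `G = w · x₀^δ`
    have hX'val : ((X' : S₁) : L) = ((z 0 : S₀) : L) := rfl
    have hw'val : ((w' : S₁) : L) = ((wB : blowupRing S₀ ((z 0 : S₀) : L)) : L) := rfl
    have hX'L : ((z 0 : S₀) : L) = ((v : S₁) : L) * ((x₀ : S₁) : L) := by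
      rw [← hX'val, ← hv, Subring.coe_mul]
    have h1 : ((wB : blowupRing S₀ ((z 0 : S₀) : L)) : L) * ((z 0 : S₀) : L) ^ δ =
        ((wB : blowupRing S₀ ((z 0 : S₀) : L)) : L) * (((v : S₁) : L) * ((x₀ : S₁) : L)) ^ δ := by
      rw [← hX'L]
    rw [hGw, h1, Subring.coe_mul, Subring.coe_pow, hw'val, mul_pow]
    ring
  · rw [hI]
    exact (Ideal.Quotient.isDomain_iff_prime _).mp (isDomain_of_isRegularLocalRing _)
  · rw [hI]; exact hreg
  · rw [hI, hn, hn1]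

end Summit.ResolutionOfSingularities.ResolutionOfSingularities.Theorems.SwitchingDichotomy.ClaimR
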